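import Summits.QuantumFields.YangMills.Theorems.AlphaInputsT3ACv3RegionAxialGauge
import HarnessLib

/-!
# S2β · D-GUARD ∕ (BG∞) — THE CORNER AXIAL GAUGE ON A CLOSED BLOCK OF THE TORUS: `dist1 ((axialT V y • V) b) ≤ (Σ_κ ℓ_κ)·θ` for every bond `b = ⟨x, μ⟩` with
# `(x_κ − y_κ).val ≤ ℓ_κ` and `2(ℓ_κ + 1) ≤ N` — Step A ∕ (G1) of UV3-NODE §116.3 as a transport of ✓`RegionAxialGauge.dist1_gaugeActT_axialT_le_of_box` under a
# GLOBAL plaquette window (the (BG∞) setting: `PlaqSmall θ V` on the whole torus), and the `(4ρ+6)θ` edition of the HOME sketch's `stub_localGauges`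

Cell `ym3-torus` (YM ladder rung R3 = continuum `SU(2)` Yang–Mills on the three-torus at fixed lattice data — a RUNG: NOT d = 4, NOT infinite volume,
NOT a mass gap, NOT Clay).  Width seat «width 19» `ym3-torus-px19` (gen 25, ★p1 lineage), FREE px helper on crux `stmt-QuantumFields-20520`
(`FluctuationComparisonRegPrIntL`; registry `Lines/semiclassical_s2beta.lean` UNTOUCHED, 0∕5); `--kind proof --supports stmt-QuantumFields-20520 --as helper`,
count-neutral, DEFINITION-FREE (0 `def`, 0 `instance`, 0 `notation`, 0 `sorry`, default heartbeats).  (BG∞) plan of record: UV3-NODE §116 (architect ruling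
px17 g23 2026-09-01T00:13:02Z; desk RULING №123); this is gap-list item (G1) «transport», the `stub_localGauges` of the HOME sketch `HsuppPlus-SKETCH` (px19 g25).

WHY.  Step A of the (BG∞) gluing gauges every CLOSED block `Q̄ = {x : ∀ κ, (x_κ − y_κ).val ≤ ℓ_κ}` (corner `y`, sides `ℓ_κ ≍ θ^{−1∕2}`) by the torus axial gauge
based at its corner.  The tree's regional theorem ✓`RegionAxialGauge.dist1_gaugeActT_axialT_le_of_box` bounds the gauged bond at `⟨x, μ⟩` by `l1(rel y x)·δ` from
the plaquettes of a coordinate box around the comb fan, provided the bond does not wrap (`(rel y x μ + 1)·2 ≤ N`).  Under the GLOBAL window `PlaqSmall θ V` of the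
(BG∞) statement the box hypothesis is vacuous (`I_κ := univ`), and on a closed block whose sides satisfy `2(ℓ_κ + 1) ≤ N` the relative coordinates ARE the
offsets: `rel y x κ = (x_κ − y_κ).val ≤ ℓ_κ` (the symmetric representative equals the least one below `N∕2`), so `l1(rel y x) ≤ Σ_κ ℓ_κ` and the bond does not wrap.

WHAT IS PROVED (sorry-free; any `[GaugeGroup G]`, any `Params`, any level `j`).
* §1 `rel_eq_val_of_two_mul_le` (`2((x_κ − y_κ).val + 1) ≤ N ⟹ rel y x κ = (x_κ − y_κ).val`), `rel_nonneg_of`, `rel_le_of`, ★ `l1_rel_le_sum` (`l1 (rel y x) ≤ Σ_κ ℓ_κ`).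
* §2 ★★★ `dist1_gaugeAct_axialT_le_of_closedBlock` — `PlaqSmall θ V`, `0 ≤ θ`, `∀ κ, (x_κ − y_κ).val ≤ ℓ_κ`, `∀ κ, (ℓ_κ + 1)·2 ≤ N` ⟹
  `dist1 (GaugeField.gaugeAct (axialT V y) V ⟨x, μ⟩) ≤ (Σ_κ ℓ_κ : ℕ)·θ`.
* §3 ★★ `dist1_gaugeAct_axialT_le_of_closedBlock_rho` — the sketch's letter: `P.d = 3`, `1 ≤ ρ`, `8ρ ≤ N`, `3ℓ_κ ≤ 4ρ + 3` ⟹ `≤ (4ρ + 6)·θ` (so `stub_localGauges` of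
  `HsuppPlus-SKETCH` is this theorem once `ParityBlocks.closed` is unfolded).

HONEST SCOPE.  `ZMod`∕`valMinAbs` bookkeeping over the tree's regional axial gauge; nothing of Bałaban's renormalisation-group analysis is asserted or proved
([Balaban1985Averaging] pp.24–25 and [Balaban1985RegularSpaces] Lemma 1 (1.24)–(1.25) p.79: the axial gauge with small bond variables — the CUBE statement print
has; the torus-global (BG∞) is NOT in print and NOT proved here).  (G6) blocks, (G7) fillings, (G8) filing, Case S are OPEN; GAP♯∘ (`stub_uniformFibreGapOrbit`,
registry UNTOUCHED), the five registered stubs (0∕5), S2β, 20520, 19936, 19200, `YM3TorusSU2` are NOT proved; no registered stub is closed; rung R3 — NOT d = 4,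
NOT infinite volume, NOT a mass gap, NOT Clay; the Yang–Mills mass gap is NOT proved.  Axioms standard.

References: T. Bałaban, CMP **98** (1985) 17–51 [Balaban1985Averaging] (pp.24–25); CMP **99** (1985) 75–102 [Balaban1985RegularSpaces] (Lemma 1 (1.24)–(1.25) p.79,
(1.29) p.81).
-/

set_option autoImplicit false

noncomputable section

namespace Summit.QuantumFields.YangMills.Theorems.FluctuationComparisonRegPrIntLS2BetaClosedBlockAxialGauge

open Literature.MathematicalPhysics.QuantumFieldTheory.Balaban1983to89
open B10Eq27TorusAxialLog (axialT gaugeActT rel rel_apply gaugeActT_eq_gaugeAct)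
open B7Prop1Explicit (l1)
open Summit.QuantumFields.YangMills.Theorems.RegionAxialGauge (dist1_gaugeActT_axialT_le_of_box)

variable {P : Params} {j : ℕ}

/-! ## §1 On a closed block the symmetric relative coordinates are the offsets -/

/-- Below half the period the symmetric representative is the least one: `2((x_κ − y_κ).val + 1) ≤ N ⟹ rel y x κ = (x_κ − y_κ).val`. [folklore] -/
theorem rel_eq_val_of_two_mul_le (y x : Site P j) (κ : Fin P.d) (h : ((x κ - y κ).val + 1) * 2 ≤ P.sitesPerDir j) :
    rel y x κ = ((x κ - y κ).val : ℤ) := by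
  rw [rel_apply, ZMod.valMinAbs_def_pos]
  have hle : (x κ - y κ).val ≤ P.sitesPerDir j / 2 := by
    rw [Nat.le_div_iff_mul_le two_pos]
    omega
  rw [if_pos hle]

/-- Hence `0 ≤ rel y x κ`. [folklore] -/
theorem rel_nonneg_of (y x : Site P j) (κ : Fin P.d) (h : ((x κ - y κ).val + 1) * 2 ≤ P.sitesPerDir j) : 0 ≤ rel y x κ := by
  rw [rel_eq_val_of_two_mul_le y x κ h]
  exact Int.natCast_nonneg _

/-- And `rel y x κ ≤ ℓ_κ` when the offset is `≤ ℓ_κ` with `2(ℓ_κ + 1) ≤ N`. [folklore] -/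
theorem rel_le_of (y x : Site P j) (κ : Fin P.d) {ℓ : ℕ} (hx : (x κ - y κ).val ≤ ℓ) (hℓ : (ℓ + 1) * 2 ≤ P.sitesPerDir j) :
    rel y x κ ≤ (ℓ : ℤ) := by
  have h : ((x κ - y κ).val + 1) * 2 ≤ P.sitesPerDir j := le_trans (by omega) hℓ
  rw [rel_eq_val_of_two_mul_le y x κ h]
  exact_mod_cast hx

/-- ★ **`l1 (rel y x) ≤ Σ_κ ℓ_κ`** on the closed block. [folklore] -/
theorem l1_rel_le_sum (y x : Site P j) (ℓ : Fin P.d → ℕ) (hx : ∀ κ, (x κ - y κ).val ≤ ℓ κ) (hℓ : ∀ κ, (ℓ κ + 1) * 2 ≤ P.sitesPerDir j) :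
    l1 (rel y x) ≤ ∑ κ, ℓ κ := by
  unfold l1
  refine Finset.sum_le_sum fun κ _ => ?_
  have h : ((x κ - y κ).val + 1) * 2 ≤ P.sitesPerDir j := le_trans (by have := hx κ; omega) (hℓ κ)
  rw [rel_eq_val_of_two_mul_le y x κ h, Int.natAbs_natCast]
  exact hx κ

/-! ## §2 The corner axial gauge on a closed block under a global plaquette window -/

/-- ★★★ **THE CORNER AXIAL GAUGE ON A CLOSED BLOCK**: under the GLOBAL window `PlaqSmall θ V` (all plaquettes of the torus within `θ` of `1`), the torus axial gauge
based at `y` makes every bond `⟨x, μ⟩` with offsets `(x_κ − y_κ).val ≤ ℓ_κ`, `2(ℓ_κ + 1) ≤ N`, satisfy `dist1 ≤ (Σ_κ ℓ_κ)·θ` (✓`RegionAxialGauge.dist1_gaugeActT_axialT_le_of_box`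
with `I := univ`: the box hypothesis is vacuous, the wrap hypothesis is `rel y x μ ≤ ℓ_μ`). [cite: Balaban1985Averaging, pp.24-25; Balaban1985RegularSpaces, Lemma 1 p.79] -/
theorem dist1_gaugeAct_axialT_le_of_closedBlock {G : Type*} [GaugeGroup G] (V : GaugeField P j G) {θ : ℝ} (hθ : 0 ≤ θ) (hV : PlaqSmall θ V)
    (y x : Site P j) (ℓ : Fin P.d → ℕ) (hx : ∀ κ, (x κ - y κ).val ≤ ℓ κ) (hℓ : ∀ κ, (ℓ κ + 1) * 2 ≤ P.sitesPerDir j) (μ : Fin P.d) :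
    dist1 (GaugeField.gaugeAct (axialT V y) V ⟨x, μ⟩) ≤ ((∑ κ, ℓ κ : ℕ) : ℝ) * θ := by
  -- the regional theorem with the vacuous box `I := univ`
  have hwrap : (rel y x μ + 1) * 2 ≤ (P.sitesPerDir j : ℤ) := by
    have h1 := rel_le_of y x μ (hx μ) (hℓ μ)
    have h2 : (((ℓ μ + 1) * 2 : ℕ) : ℤ) ≤ (P.sitesPerDir j : ℤ) := by exact_mod_cast hℓ μ
    push_cast at h2
    linarith
  have h := dist1_gaugeActT_axialT_le_of_box V (I := fun _ => Set.univ) hθ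
    (fun q _ _ => (hV q).le) y x μ hwrap (fun κ t _ _ => Set.mem_univ _)
  rw [gaugeActT_eq_gaugeAct] at h
  refine h.trans (mul_le_mul_of_nonneg_right ?_ hθ)
  exact_mod_cast l1_rel_le_sum y x ℓ hx hℓ

/-! ## §3 The sketch's letter: `(4ρ + 6)·θ` on the parity blocks of a 3-torus -/

/-- ★★ **THE `(4ρ+6)θ` EDITION** (`stub_localGauges` of the HOME sketch `HsuppPlus-SKETCH`, unfolded): on a 3-torus with `8ρ ≤ N`, `1 ≤ ρ`, a closed block of
sides `ℓ_κ` with `3ℓ_κ ≤ 4ρ + 3` is gauged by its corner axial gauge to `dist1 ≤ (4ρ + 6)·θ`. [cite: Balaban1985RegularSpaces, Lemma 1 (1.24)-(1.25) p.79] -/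
theorem dist1_gaugeAct_axialT_le_of_closedBlock_rho {G : Type*} [GaugeGroup G] (hd : P.d = 3) {ρ : ℕ} (hρ : 1 ≤ ρ)
    (hN : 8 * ρ ≤ P.sitesPerDir j) (V : GaugeField P j G) {θ : ℝ} (hθ : 0 ≤ θ) (hV : PlaqSmall θ V)
    (y x : Site P j) (ℓ : Fin P.d → ℕ) (hℓρ : ∀ κ, 3 * ℓ κ ≤ 4 * ρ + 3) (hx : ∀ κ, (x κ - y κ).val ≤ ℓ κ) (μ : Fin P.d) :
    dist1 (GaugeField.gaugeAct (axialT V y) V ⟨x, μ⟩) ≤ (4 * ρ + 6) * θ := by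
  have hℓ : ∀ κ, (ℓ κ + 1) * 2 ≤ P.sitesPerDir j := fun κ => by
    have := hℓρ κ
    omega
  refine (dist1_gaugeAct_axialT_le_of_closedBlock V hθ hV y x ℓ hx hℓ μ).trans (mul_le_mul_of_nonneg_right ?_ hθ)
  -- `Σ_{κ<3} ℓ_κ ≤ 4ρ + 3 ≤ 4ρ + 6`
  have hsum : ∑ κ, ℓ κ ≤ 4 * ρ + 6 := by
    have h3 : ∀ κ, 3 * ℓ κ ≤ 4 * ρ + 3 := hℓρ
    have hcard : (Finset.univ : Finset (Fin P.d)).card = 3 := by rw [Finset.card_univ, Fintype.card_fin, hd]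
    have hs : 3 * ∑ κ, ℓ κ ≤ ∑ _κ : Fin P.d, (4 * ρ + 3) := by
      rw [Finset.mul_sum]
      exact Finset.sum_le_sum fun κ _ => h3 κ
    rw [Finset.sum_const, hcard, smul_eq_mul] at hs
    omega
  exact_mod_cast hsum

end Summit.QuantumFields.YangMills.Theorems.FluctuationComparisonRegPrIntLS2BetaClosedBlockAxialGauge

end
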